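import Summits.HodgeConjecture.HodgeConjecture.Theorems.MarkmanPartnerTransportK3Sq2TypeHodgeOfPicardThree
import Summits.HodgeConjecture.HodgeConjecture.Theorems.MarkmanPartnerTransportPicardThreeK3SquaresHighPicard

/-!
# Route MarkmanPartnerTransport · target `K3Sq2TypeHodge` (stmt-HodgeConjecture-19649) at `ρ(X) ≥ 4`
# FROM THE REAL-MULTIPLICATION THIRD OF K3 SQUARES AT `3 ≤ ρ(S) ≤ 16` ALONE

Composition of `hodgeConjectureFor_of_picardThreeK3Squares_of_four_le` (gen 6: at `ρ(X) ≥ 4` the target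
hangs on the crux `PicardThreeK3Squares`, modulo the five facts of `PartnerExistence`/`PartnerTransport`)
with `HighPicard.picardThreeK3Squares_of_realMultiplicationThird_le_sixteen` (gen 0: the crux from the
cycle-induced sector clause on NON-CM, NON-scalar K3 surfaces with `3 ≤ ρ(S) ≤ 16`, modulo Buskin and
markings):

* `hodgeConjectureFor_of_rmThird_of_four_le` — **(seven named facts) → [cycle-induced sector clause for
  every projective K3 surface `S` with `3 ≤ ρ(S) ≤ 16`, `End_Hdg T(S)` a totally real field `≠ ℚ`] →
  HC⁴ for every marked smooth projective `K3^{[2]}`-type fourfold with `ρ(X) ≥ 4`.**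

The bracket is the genuinely OPEN real-multiplication problem for K3 squares (van Geemen 2008; known only on
the van Geemen–Schütt cycle-induced families and the Kuga–Satake/`√2`/`√3`/`√6` sectors recorded under
`…PicardThreeK3SquaresResidue*`).  CONDITIONAL; credits nothing.  No definition, no sorry.
Prover seat hodge-nonav-19652-p1 (gen 6), `--supports stmt-HodgeConjecture-19649`.

References: E. Markman, Compos. Math. 160 (2024); N. Buskin, J. reine angew. Math. 755 (2019) Thm. 1.1;
B. van Geemen, *Real multiplication on K3 surfaces and Kuga–Satake varieties*, Michigan Math. J. 56 (2008)
Lemma 3.2; Yu. Zarhin, J. reine angew. Math. 341 (1983) Thm. 1.5.1.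
-/

noncomputable section

set_option linter.dupNamespace false

open Module CategoryTheory MonoidalCategory
open Literature.AlgebraicTopology.SingularHomology
open Literature.AlgebraicGeometry Literature.AlgebraicGeometry.Motives Literature.AlgebraicGeometry.HodgeTheory
open Literature.AlgebraicGeometry.Hyperkaehler Literature.AlgebraicGeometry.Surfaces
open Literature.AlgebraicGeometry.HilbertScheme
open Summit.HodgeConjecture.HodgeConjecture.Theorems.NikulinTwinTransport
open Summit.HodgeConjecture.HodgeConjecture.Theorems.MarkmanPartnerTransport

namespace Summit.HodgeConjecture.HodgeConjecture.Theorems.MarkmanPartnerTransport.PartnerLattice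

/-- `MarkedK3Sq[X, φ, P, z]`: VERBATIM the `let MarkedK3Sq := …` binder of the route declarations of
MarkmanPartnerTransport (clauses (m1)–(m6)). Local notation only. -/
local notation3 (prettyPrint := false) "MarkedK3Sq[" X ", " φ ", " P ", " z "]" =>
  (((IsIntegralClass P ∧ ∀ Q : complexBetti X (2 * 4), IsIntegralClass Q → ∃ n : ℤ, Q = n • P) ∧
    (∀ c : complexBetti X 2, IsIntegralClass c ↔ ∃ v : K3HilbertIndex → ℤ, φ c = fun i => (v i : ℂ)) ∧
    (∀ a : complexBetti X 2, cupPowTwo a 4 = ((3 : ℂ) * (k3HilbertForm 2 (φ a) (φ a)) ^ 2) • P) ∧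
    (IsOfHodgeType 4 X 2 2 0 (LinearEquiv.symm φ z) ∧
      ∀ τ : complexBetti X 2, IsOfHodgeType 4 X 2 2 0 τ → ∃ t : ℂ, τ = t • LinearEquiv.symm φ z) ∧
    (∀ c : complexBetti X 2, IsOfHodgeType 4 X 2 1 1 c ↔
      (k3HilbertForm 2 (φ c) z = 0 ∧ k3HilbertForm 2 (φ c) (star z) = 0)) ∧
    (k3HilbertForm 2 z z = 0 ∧ 0 < (k3HilbertForm 2 (star z) z).re)))

/-- `Corr[μ, hS ; γ, y] = pr₁_*(pr₂^* y ∪ γ)` on `H²(S(ℂ); ℂ)`. Local notation only. -/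
local notation3 (prettyPrint := false) "Corr[" μ ", " hS " ; " γ ", " y "]" =>
  complexGysin μ (IsSmoothProjective.tensor_holds hS hS) hS
    (SemiCartesianMonoidalCategory.fst _ _) (rfl : 2 * 1 + 2 * 2 + 2 * 2 = 2 * 1 + 2 * (2 + 2))
    (cupProduct (rfl : 2 * 1 + 2 * 2 = 2 * 1 + 2 * 2)
      (complexBetti.map (SemiCartesianMonoidalCategory.snd _ _) (2 * 1) y) γ)

/-- **The route's target at `ρ(X) ≥ 4` from the real-multiplication third of K3 squares at
`3 ≤ ρ(S) ≤ 16` alone** (module docstring), modulo seven published named facts.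
[cite: Markman2024, §1.1 Thm. 1.1 and Thm. 1.4] [cite: Buskin2019, Thm. 1.1] [cite: Vangeemen2008, Lemma 3.2]
[cite: Zarhin1983HodgeGroupsK3, Thm. 1.5.1] -/
theorem hodgeConjectureFor_of_rmThird_of_four_le (hP : Huybrechts_K3_periodSurjective_projective)
    (hB : Beauville1983_hilbertSquare_markedIncidence)
    (hρ : Beauville1983_hilbertSquare_blowupDiagonal_surjection)
    (hMk : Markman2024_rationalHodgeIsometry_lift_algebraic_marked)
    (hcup : Voisin2003_cupProduct_algebraicClasses) (hBu : Buskin2019_hodgeIsometry_algebraic)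
    (hmark : Huybrechts_K3_marking_exists)
    (hRM : ∀ (S : SchemeOver ℂ) (hS : IsK3Surface S), ¬ HasComplexMultiplication S →
      3 ≤ Module.finrank ℂ ↥(algebraicClasses S 1) → Module.finrank ℂ ↥(algebraicClasses S 1) ≤ 16 →
      (¬ ∀ (f : complexBetti S (2 * 1) →ₗ[ℂ] complexBetti S (2 * 1)),
        (∀ y, IsRationalClass y → IsRationalClass (f y)) →
        (∀ (i j : ℕ) y, IsOfHodgeType 2 S (2 * 1) i j y → IsOfHodgeType 2 S (2 * 1) i j (f y)) →
        (∀ d ∈ algebraicClasses S 1, f d = 0) →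
        (∀ y : complexBetti S (2 * 1), ∀ d ∈ algebraicClasses S 1,
          cupProduct (rfl : 2 * 1 + 2 * 1 = 2 * 2) (f y) d = 0) →
        ∃ a : ℚ, ∀ y : complexBetti S (2 * 1),
          (∀ d ∈ algebraicClasses S 1, cupProduct (rfl : 2 * 1 + 2 * 1 = 2 * 2) y d = 0) →
            f y = (a : ℂ) • y) →
      ∀ (f : complexBetti S (2 * 1) →ₗ[ℂ] complexBetti S (2 * 1)),
        (∀ y, IsRationalClass y → IsRationalClass (f y)) →
        (∀ (i j : ℕ) y, IsOfHodgeType 2 S (2 * 1) i j y → IsOfHodgeType 2 S (2 * 1) i j (f y)) →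
        (∀ d ∈ algebraicClasses S 1, f d = 0) →
        (∀ y : complexBetti S (2 * 1), ∀ d ∈ algebraicClasses S 1,
          cupProduct (rfl : 2 * 1 + 2 * 1 = 2 * 2) (f y) d = 0) →
        ∃ g : complexBetti S (2 * 1) →ₗ[ℂ] complexBetti S (2 * 1),
          (∀ d ∈ algebraicClasses S 1, g d ∈ algebraicClasses S 1) ∧
          (∃ γ ∈ algebraicClasses (S ⊗ S) 2, ∀ y : complexBetti S (2 * 1),
            g y = Corr[complexOrientationFamily, hS.isSmoothProjective ; γ, y]) ∧
          ∀ y : complexBetti S (2 * 1),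
            (∀ d ∈ algebraicClasses S 1, cupProduct (rfl : 2 * 1 + 2 * 1 = 2 * 2) y d = 0) →
              f y = g y)
    {X : SchemeOver ℂ} (hX : IsSmoothProjective 4 X) (hK : IsOfK3HilbertSquareType X)
    {φ : complexBetti X 2 ≃ₗ[ℂ] (K3HilbertIndex → ℂ)} {P : complexBetti X (2 * 4)} {z : K3HilbertIndex → ℂ}
    (hM : MarkedK3Sq[X, φ, P, z]) (h4 : 4 ≤ Module.finrank ℂ (algebraicClasses X 1)) :
    HodgeConjectureFor 4 X :=
  hodgeConjectureFor_of_picardThreeK3Squares_of_four_le hP hB hρ hMk hcup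
    (HighPicard.picardThreeK3Squares_of_realMultiplicationThird_le_sixteen hBu hmark hRM) hX hK hM h4

end Summit.HodgeConjecture.HodgeConjecture.Theorems.MarkmanPartnerTransport.PartnerLattice

end
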